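import Literature.Geometry.Riemannian.RicciDeTurckChartFamily
import Literature.Geometry.Lorentzian.ChartMetricCoord
import Literature.Geometry.Lorentzian.CoordScalarCurvatureVariation
import Literature.Geometry.Lorentzian.RicciDecay
import Literature.Geometry.Lorentzian.RicciSection
import Literature.Geometry.Lorentzian.RicciVariationSteps
import HarnessLib

/-!
# The Ricci variation of Schoen–Yau: `R'₀ = -‖Ric‖²` (step `hb`)

Schoen–Yau, Comm. Math. Phys. 65 (1979), §3, p. 73, (3.24)–(3.25): for the family
`ds²_t = ds² + t Ric` on a scalar flat `3`-manifold, *"A known formula (see [20]) gives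
`R'₀ = -Δ(tr Ric) + δδ Ric - ‖Ric‖²` … Since `R ≡ 0`, we have `ΔR = 0`, and a direct
application of the second Bianchi identity shows `δδ Ric = ½ ΔR = 0`. Thus `R'₀ = -‖Ric‖²`"*.
This file **proves** that step, for an arbitrary family of data `D_t` with metric `h + t Ric(h)`
on `|t| < τ`; it is consumed by the reduction of step 2 of positive mass rigidity to the elliptic
steps of the printed proof (`exists_ricciVariation_negativeMass_of_massZero_of_elliptic_steps`,
`RicciVariationEllipticSteps.lean`):

* the identity is local and tensorial, so it is proved in the atlas chart at `x` with the chart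
  machinery of `Literature/Geometry/Riemannian/RicciDeTurckChartFamily.lean` (`chartRep`,
  `chartInv`, `chartPullback`): the components of `h_t` are `G₀ + t T`, `T` the components of
  `Ric(h)`, which by naturality (`ricci_comap_apply`) and `OpensChart.ricci_eq_ricAt` are
  `Ric(G₀)` (`ricAt_chartRep_apply`); this is a smooth one-parameter family
  (`MetricCoord.IsMetricFamilyOn`) with `∂G/∂t = Ric(G₀)` at `t = 0`;
* `MetricCoord.IsMetricFamilyOn.hasDerivWithinAt_scalAt_of_tDeriv_eq`
  (`CoordScalarCurvatureVariation.lean`, Topping's route through Prop. 2.3.1/2.3.9 and the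
  contracted Bianchi identity) gives `∂_t S = -|Ric|² - ½ ΔS` at `t = 0`, and `S(G₀) ≡ 0` kills
  the Laplacian (`MetricCoord.lapAt_eq_zero_of_eventuallyEq_zero`);
* the transport back to `X`: `scalAt_chartRep_eq_scalarCurvatureFn` (`scalarCurvature_comap`,
  `OpensChart.scalarCurvature_eq_scalAt`) and `normSqAt_ricAt_chartRep_eq`
  (`normSq_ricci_comap`, `OpensChart.normSq_ricci_eq_normSqAt`).

Main statement: `hasDerivAt_scalarCurvatureFn_ricciVariation`. Everything is proved; no named
fact is introduced.

## References

* R. Schoen, S.-T. Yau, *On the proof of the positive mass conjecture in general relativity*,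
  Comm. Math. Phys. 65 (1979) 45–76, §3, p. 73, (3.24)–(3.25).
* J. Kazdan, F. Warner, *Prescribing curvatures*, Proc. Sympos. Pure Math. 27 (1975) 309–319
  ([20] of Schoen–Yau: the first variation of the scalar curvature).
* P. Topping, *Lectures on the Ricci flow*, CUP 2006, Prop. 2.3.9.
* B. O'Neill, *Semi-Riemannian geometry* (1983), Ch. 3, Prop. 3.59, Cor. 3.54.
-/

noncomputable section

set_option maxSynthPendingDepth 3

open Bundle Set Function Filter Module TopologicalSpace
open scoped Manifold ContDiff Topology

namespace Literature.Geometry.Lorentzian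

open Literature.Geometry.Riemannian PseudoRiemannianMetric

/-! ### A Laplacian lemma -/

/-- The coordinate Laplacian of a function vanishing near `x` vanishes at `x`. [folklore] -/
theorem MetricCoord.lapAt_eq_zero_of_eventuallyEq_zero {E : Type*} [NormedAddCommGroup E]
    [NormedSpace ℝ E] [FiniteDimensional ℝ E] (G : E → E →L[ℝ] E →L[ℝ] ℝ) {f : E → ℝ} {x : E}
    (hf : f =ᶠ[𝓝 x] fun _ ↦ (0 : ℝ)) : MetricCoord.lapAt G f x = 0 := by
  have hd1 : fderiv ℝ f x = 0 := by
    rw [hf.fderiv_eq, fderiv_fun_const]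
    rfl
  have hd2 : fderiv ℝ (fderiv ℝ f) x = 0 := by
    have h : fderiv ℝ f =ᶠ[𝓝 x] fun _ ↦ (0 : E →L[ℝ] ℝ) :=
      hf.fderiv.trans (Filter.Eventually.of_forall fun y ↦ by rw [fderiv_fun_const]; rfl)
    rw [h.fderiv_eq, fderiv_fun_const]
    rfl
  rw [MetricCoord.lapAt_eq_sum G (Module.finBasis ℝ E)]
  simp only [hd1, hd2, _root_.zero_apply, sub_zero, mul_zero,
    Finset.sum_const_zero]

/-! ### Curvature objects of data read in an atlas chart -/

section ChartBridge

variable {X : Type} [TopologicalSpace X] [ChartedSpace E3 X] [IsManifold (𝓡 3) ∞ X]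

/-- **The scalar curvature of a family of data read in the chart at `x`**:
`S(G s)(u) = R(h_s)(Φ u)` for the chart components `G s = chartRep (h_s)` and the inverse extended
chart `Φ = chartInv` (`scalarCurvature_comap`, `OpensChart.scalarCurvature_eq_scalAt`).
[cite: ONeill1983, Ch. 3, Prop. 3.59] -/
theorem scalAt_chartRep_eq_scalarCurvatureFn (Dt : ℝ → InitialDataSet (𝓡 3) X) (x : X) (s : ℝ)
    (u : chartTarget (𝓡 3) x) :
    MetricCoord.scalAt (chartRep (𝓡 3) (fun s ↦ (Dt s).metric) x s) u =
      (Dt s).scalarCurvatureFn (chartInv (𝓡 3) x u) := by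
  haveI := (Dt s).metric.hasLeviCivita
  haveI := (chartPullback (𝓡 3) (Dt s).metric x).hasLeviCivita
  rw [← OpensChart.scalarCurvature_eq_scalAt
      (val_chartPullback_eq_chartRep (fun s ↦ (Dt s).metric) x s) u,
    (Dt s).metric.scalarCurvature_comap contMDiff_pullbackBilin_holds (contMDiff_chartInv x)
      (injective_mfderiv_chartInv x) rfl u]
  rfl

/-- **The Ricci tensor of data read in the chart at `x`**: the coordinate Ricci form of the
components `G₀ = chartRep h` at `u` is `Ric(h)` at `Φ u` on the frame vectors of the
trivialization at `x` (`OpensChart.ricci_eq_ricAt`, `ricci_comap_apply`,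
`mfderiv_chartInv_eq_symmL`). [cite: ONeill1983, Ch. 3, Prop. 3.59] -/
theorem ricAt_chartRep_apply (D : InitialDataSet (𝓡 3) X) [D.metric.HasLeviCivita] (x : X)
    (u : chartTarget (𝓡 3) x) (v w : E3) :
    MetricCoord.ricAt (chartRep (𝓡 3) (fun _ ↦ D.metric) x 0) u v w =
      D.metric.ricci (chartInv (𝓡 3) x u)
        ((trivializationAt E3 (TangentSpace (𝓡 3) : X → Type _) x).symmL ℝ (chartInv (𝓡 3) x u) v)
        ((trivializationAt E3 (TangentSpace (𝓡 3) : X → Type _) x).symmL ℝ (chartInv (𝓡 3) x u) w) := by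
  haveI := (chartPullback (𝓡 3) D.metric x).hasLeviCivita
  rw [← OpensChart.ricci_eq_ricAt (val_chartPullback_eq_chartRep (fun _ ↦ D.metric) x 0) u v w,
    D.metric.ricci_comap_apply contMDiff_pullbackBilin_holds (contMDiff_chartInv x)
      (injective_mfderiv_chartInv x) rfl u v w,
    mfderiv_chartInv_eq_symmL x u v, mfderiv_chartInv_eq_symmL x u w]

/-- **`|Ric|²` of data read in the chart at `x`**: `|Ric(G₀)|²_{G₀}(u) = ‖Ric(h)‖²_h(Φ u)`
(`OpensChart.normSq_ricci_eq_normSqAt`, `normSq_ricci_comap`). [cite: ONeill1983, Ch. 3, Prop. 3.59] -/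
theorem normSqAt_ricAt_chartRep_eq (D : InitialDataSet (𝓡 3) X) [D.metric.HasLeviCivita] (x : X)
    (u : chartTarget (𝓡 3) x) :
    MetricCoord.normSqAt (chartRep (𝓡 3) (fun _ ↦ D.metric) x 0) u
        (MetricCoord.ricAt (chartRep (𝓡 3) (fun _ ↦ D.metric) x 0) u) =
      D.metric.normSq (chartInv (𝓡 3) x u) (D.metric.ricci (chartInv (𝓡 3) x u)) := by
  haveI := (chartPullback (𝓡 3) D.metric x).hasLeviCivita
  rw [← OpensChart.normSq_ricci_eq_normSqAt (val_chartPullback_eq_chartRep (fun _ ↦ D.metric) x 0) u,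
    D.metric.normSq_ricci_comap contMDiff_pullbackBilin_holds (contMDiff_chartInv x)
      (injective_mfderiv_chartInv x) rfl u]

end ChartBridge

/-! ### `R'₀ = -‖Ric‖²` -/

variable {X : Type} [TopologicalSpace X] [ChartedSpace E3 X] [IsManifold (𝓡 3) ∞ X]

set_option maxHeartbeats 800000 in
-- the chart components `chartRep` unfold to nested `gramOpFamily`/`bilinearComp` terms whose
-- definitional unfolding in the family construction is expensive
/-- **The first variation of the scalar curvature along `ds² + t Ric` when `R ≡ 0`**
(Schoen–Yau, Comm. Math. Phys. 65 (1979), p. 73, (3.24)–(3.25): *"A known formula (see [20]) gives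
`R'₀ = -Δ(tr Ric) + δδ Ric - ‖Ric‖²` … Since `R ≡ 0`, we have `ΔR = 0`, and a direct
application of the second Bianchi identity shows `δδ Ric = ½ ΔR = 0`. Thus `R'₀ = -‖Ric‖²`"*):
for data `D` with `R(h) ≡ 0` and any family `D_t` with metric `h + t Ric(h)` on `|t| < τ`, the
scalar curvature `t ↦ R(h_t)(x)` has derivative `-‖Ric‖²_h(x)` at `t = 0`. Proof: in the chart at
`x` the components of `h_t` are `G₀ + t T` with `T` the components of `Ric(h) = Ric(G₀)`
(naturality), a smooth family with `∂G/∂t = Ric(G₀)` at `t = 0`; by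
`hasDerivWithinAt_scalAt_of_tDeriv_eq` (`c = 1`) the derivative is `-|Ric|² - ½ ΔS`, and `S ≡ 0`
kills the Laplacian; the coordinate objects are transported back by `scalarCurvature_comap`,
`normSq_ricci_comap` and `ChartMetricCoord.lean`. Consumed by
`exists_ricciVariation_massFunctionAt_of_elliptic_steps` (`RicciVariationEllipticSteps.lean`).
[cite: SchoenYauPMT1979, §3 (3.24)–(3.25), p. 73] -/
theorem hasDerivAt_scalarCurvatureFn_ricciVariation
    (D : InitialDataSet (𝓡 3) X) [D.metric.HasLeviCivita] {τ : ℝ} (hτ : 0 < τ)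
    (Dt : ℝ → InitialDataSet (𝓡 3) X) (hR0 : ∀ x : X, D.metric.scalarCurvature x = 0)
    (hDt : ∀ t : ℝ, |t| < τ → ∀ (x : X) (v w : TangentSpace (𝓡 3) x),
      (Dt t).metric.val x v w = D.metric.val x v w + t * D.metric.ricci x v w)
    (x : X) :
    HasDerivAt (fun t ↦ (Dt t).scalarCurvatureFn x) (-(D.metric.normSq x (D.metric.ricci x))) 0 := by
  -- the family of metrics, its chart components at `x`, and the time set
  set g : ℝ → PseudoRiemannianMetric (𝓡 3) ∞ E3 (TangentSpace (𝓡 3) : X → Type _) :=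
    fun s ↦ (Dt s).metric with hg
  set S : Set ℝ := Ioo (-τ) τ with hS
  set V : Set E3 := (extChartAt (𝓡 3) x).target with hV
  set G : ℝ → E3 → E3 →L[ℝ] E3 →L[ℝ] ℝ := chartRep (𝓡 3) g x with hGdef
  set G₀ : E3 → E3 →L[ℝ] E3 →L[ℝ] ℝ := chartRep (𝓡 3) (fun _ ↦ D.metric) x 0 with hG₀
  set e := trivializationAt E3 (TangentSpace (𝓡 3) : X → Type _) x with he
  set T : E3 → E3 →L[ℝ] E3 →L[ℝ] ℝ := fun y ↦
    ContinuousLinearMap.bilinearComp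
      (show E3 →L[ℝ] E3 →L[ℝ] ℝ from D.metric.ricciCLM ((extChartAt (𝓡 3) x).symm y))
      (show E3 →L[ℝ] E3 from e.symmL ℝ ((extChartAt (𝓡 3) x).symm y))
      (show E3 →L[ℝ] E3 from e.symmL ℝ ((extChartAt (𝓡 3) x).symm y)) with hT
  have h0S : (0 : ℝ) ∈ S := ⟨by linarith, hτ⟩
  have hSnhds : S ∈ 𝓝 (0 : ℝ) := Ioo_mem_nhds (by linarith) hτ
  have hSabs : ∀ s ∈ S, |s| < τ := fun s hs ↦ abs_lt.2 hs
  -- (1) the components are affine in `t`: `G s = G₀ + s T` for `|s| < τ`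
  have hGform : ∀ s : ℝ, |s| < τ → ∀ y : E3, G s y = G₀ y + s • T y := by
    intro s hs y
    ext v w
    exact hDt s hs _ _ _
  have hG0 : G 0 = G₀ := by
    funext y
    rw [hGform 0 (by simpa using hτ) y, zero_smul, add_zero]
  -- (2) the Ricci components: `T = Ric(G₀)` on the chart target
  have hrepr₀ : ∀ u : chartTarget (𝓡 3) x, (chartPullback (𝓡 3) D.metric x).val u = G₀ u :=
    val_chartPullback_eq_chartRep (fun _ ↦ D.metric) x 0
  have hT : ∀ y ∈ V, T y = MetricCoord.ricAt G₀ y := by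
    intro y hy
    ext v w
    exact (ricAt_chartRep_apply D x ⟨y, hy⟩ v w).symm
  -- (3) the family is a smooth one-parameter family of metric components on `V × S`
  have hmet₀ : MetricCoord.IsMetricOn G₀ V := OpensChart.isMetricOn_repr hrepr₀
  have hVopen : IsOpen V := isOpen_extChartAt_target x
  have hfam : MetricCoord.IsMetricFamilyOn G S V := by
    refine ⟨fun s _ ↦ OpensChart.isMetricOn_repr (val_chartPullback_eq_chartRep g x s), ?_,
      uniqueDiffOn_Ioo _ _, ?_⟩
    · have hG₀s : ContDiffOn ℝ ∞ G₀ V := contDiffOn_chartRep_const D.metric x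
      have hTs : ContDiffOn ℝ ∞ T V := hmet₀.contDiffOn_ricAt.congr fun y hy ↦ hT y hy
      have h1 : ContDiffOn ℝ ∞ (fun p : E3 × ℝ ↦ G₀ p.1 + p.2 • T p.1) (V ×ˢ S) :=
        (hG₀s.comp contDiffOn_fst fun p hp ↦ hp.1).add
          (contDiffOn_snd.smul (hTs.comp contDiffOn_fst fun p hp ↦ hp.1))
      exact h1.congr fun p hp ↦ hGform p.2 (hSabs p.2 hp.2) p.1
    · rw [isOpen_Ioo.interior_eq]
      exact subset_closure
  -- (4) `∂G/∂t = Ric(G 0)` at `t = 0` on `V`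
  have hfl : ∀ y ∈ V, MetricCoord.tDeriv G S 0 y = (1 : ℝ) • MetricCoord.ricAt (G 0) y := by
    intro y hy
    rw [one_smul, hG0, ← hT y hy, MetricCoord.tDeriv]
    have hd : HasDerivAt (fun s : ℝ ↦ G₀ y + s • T y) (T y) 0 := by
      simpa using ((hasDerivAt_id (0 : ℝ)).smul_const (T y)).const_add (G₀ y)
    have hd' : HasDerivWithinAt (fun s : ℝ ↦ G s y) (T y) S 0 :=
      hd.hasDerivWithinAt.congr_of_mem (fun s hs ↦ hGform s (hSabs s hs) y) h0S
    exact hd'.derivWithin (uniqueDiffOn_Ioo _ _ 0 h0S)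
  -- (5) the coordinate variation formula with `c = 1` at `t = 0`
  have hu₀ : extChartAt (𝓡 3) x x ∈ V := mem_extChartAt_target x
  set u₀ : chartTarget (𝓡 3) x := ⟨extChartAt (𝓡 3) x x, hu₀⟩ with hu₀def
  have hΦu₀ : chartInv (𝓡 3) x u₀ = x := extChartAt_to_inv x
  have key := hfam.hasDerivWithinAt_scalAt_of_tDeriv_eq (c := 1) hfl hu₀ h0S
  -- (6a) transport of the function: `S(G s)(u₀) = R(h_s)(x)`
  have hfun : ∀ s ∈ S, (Dt s).scalarCurvatureFn x =
      MetricCoord.scalAt (G s) (extChartAt (𝓡 3) x x) := fun s _ ↦ by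
    have h := scalAt_chartRep_eq_scalarCurvatureFn Dt x s u₀
    rw [hΦu₀] at h
    exact h.symm
  -- (6b) `|Ric(G 0)|²(u₀) = ‖Ric‖²_h(x)`
  have hnorm : MetricCoord.normSqAt (G 0) (extChartAt (𝓡 3) x x)
      (MetricCoord.ricAt (G 0) (extChartAt (𝓡 3) x x)) = D.metric.normSq x (D.metric.ricci x) := by
    have h := normSqAt_ricAt_chartRep_eq D x u₀
    rw [hΦu₀] at h
    rw [hG0]
    exact h
  -- (6c) `S(G 0) ≡ 0` near `u₀`, so `Δ S(G 0)(u₀) = 0`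
  have h0fn : (Dt 0).scalarCurvatureFn = D.scalarCurvatureFn :=
    InitialDataSet.scalarCurvatureFn_congr fun x v w ↦ by
      rw [hDt 0 (by simpa using hτ)]; ring
  have hS0 : ∀ y ∈ V, MetricCoord.scalAt (G 0) y = 0 := by
    intro y hy
    have h := scalAt_chartRep_eq_scalarCurvatureFn Dt x 0 ⟨y, hy⟩
    rw [h0fn, InitialDataSet.scalarCurvatureFn_eq, hR0] at h
    exact h
  have hev : MetricCoord.scalAt (G 0) =ᶠ[𝓝 (extChartAt (𝓡 3) x x)] fun _ ↦ (0 : ℝ) :=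
    Filter.eventually_of_mem (hVopen.mem_nhds hu₀) fun y hy ↦ hS0 y hy
  have hlap : MetricCoord.lapAt (G 0) (MetricCoord.scalAt (G 0)) (extChartAt (𝓡 3) x x) = 0 :=
    MetricCoord.lapAt_eq_zero_of_eventuallyEq_zero (G 0) hev
  -- (7) conclusion
  have hwithin : HasDerivWithinAt (fun t ↦ (Dt t).scalarCurvatureFn x)
      (-(D.metric.normSq x (D.metric.ricci x))) S 0 := by
    refine (key.congr_of_mem hfun h0S).congr_deriv ?_
    rw [hnorm, hlap]
    ring
  exact hwithin.hasDerivAt hSnhds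

end Literature.Geometry.Lorentzian

end
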